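import Summits.HubbardSuperconductivity.HubbardSuperconductivity.Theses.ParentFirstSMA
import Literature.MathematicalPhysics.QuantumLattice.PairFieldEvenSideLRO
import HarnessLib

/-!
# Route `ParentFirstSMA`, crux `DiluteDWavePairsCondense` (stmt-HubbardSuperconductivity-10771): the composition of line `birth`

Helper (`--supports stmt-HubbardSuperconductivity-10771`). The line `birth`
(`Cruxes/DiluteDWavePairsCondense/Lines/birth.lean`) cuts the BEC bridge `DiluteDWavePairsCondense`
(for every `U ∈ [12, 24]`: charge-gapped parent + bound `d_{x²-y²}`-coherent pairs ⇒ `d`-wave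
pair-field long-range order of EVERY `(2⌊(1-δ)L²/2⌋, S^z = 0)` ground-state sequence along even
sides at some `δ ∈ (0, 1/2)`) through Yang's two-body reduced density matrix `ρ₂(ψ_L)` of each
finite-volume sector ground state into three registered stubs:

1. `stub_pairingGapWindow` — (a) + (b) ⇒ a doping window `(0, δ₀]` with a uniform even-filling
   charge gap `b'`;
2. `stub_pairCondensation` — (a) + the window ⇒ at some `δ ≤ δ₀` every normalised sector ground
   state has a unit `ρ₂`-eigenvector with eigenvalue `≥ c L²` (Yang ODLRO, finite volume);
3. `stub_condensateDWaveLocking` — (b) + (c) ⇒ on a window `(0, δ₁]` such a macroscopic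
   eigenvector can be taken with `|⟨v, φ_d⟩|² ≥ c' L²` (`φ_d` the `d`-wave pair wavefunction).

This file proves, sorry-free and with the three stub signatures inlined VERBATIM as hypotheses
(no `def … : Prop` is introduced), that they compose to the crux BY NAME:
`diluteDWavePairsCondense_of_stubs : stub₁ → stub₂ → stub₃ → DiluteDWavePairsCondense`.
Proof: `δ* = min δ₀ δ₁`; condensation at some `δ ≤ δ*`; locking at that `δ` with the condensation
threshold `c`; then at each even side `n + 1 ≥ max L₀ L₀'` and each sector ground state,
`Σ_{x,y} G_{n+1}(x,y) = re ⟨Δ_d† Δ_d⟩ = re (φ_d† ρ₂ φ_d)` (`sum_pairFieldCorr_succ`,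
`pairField_eq_pairAnnihilator_dWave`, Yang's identity) `≥ ev ‖⟨v, φ_d⟩‖²`
(`re_dotProduct_mulVec_ge_of_eigenvector`, `ρ₂` a Gram matrix) `≥ (c L²)(c' L²)`, and the tree's
even-side bookkeeping `hasLongRangeOrder_even_of_le` gives `HasLongRangeOrder` along `k ↦ 2k`.

References: C. N. Yang, Rev. Mod. Phys. 34 (1962) 694, §4; D. J. Scalapino, Phys. Rep. 250 (1995)
329, §2; M. Randeria, J.-M. Duan, L.-Y. Shieh, Phys. Rev. Lett. 62 (1989) 981.
-/

-- the mandated namespace `Summit.<Summit>.<Problem>.Theorems` repeats `HubbardSuperconductivity`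
-- (single-problem summit, D-0017), which the `dupNamespace` linter flags on every declaration
set_option linter.dupNamespace false

noncomputable section

namespace Summit.HubbardSuperconductivity.HubbardSuperconductivity.Theorems.ParentFirstSMA

open Matrix Finset Filter
open Literature.Probability.LatticeModels Literature.MathematicalPhysics.QuantumLattice
open Summit.HubbardSuperconductivity.HubbardSuperconductivity.Theses.ParentFirstSMA
open scoped ComplexOrder

/-- **Composition of line `birth` for the crux `DiluteDWavePairsCondense`.** The three registered
stubs of `Cruxes/DiluteDWavePairsCondense/Lines/birth.lean` — pairing-gap window (`h₁`), Yang
condensation of the gapped pair gas in every sector ground state (`h₂`), `d_{x²-y²}` locking of a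
macroscopic `ρ₂`-eigenvector (`h₃`), each inlined verbatim — imply
`ParentFirstSMA.DiluteDWavePairsCondense`. The composition is Yang's inequality
`re (φ_d† ρ₂ φ_d) ≥ ev · |⟨v, φ_d⟩|²` for a unit `ρ₂`-eigenpair `(ev, v)` and the even-side
long-range-order bookkeeping of the tree. [cite: Yang1962, §4] [cite: Scalapino1995, §2] -/
theorem diluteDWavePairsCondense_of_stubs : (∀ U : ℝ, 12 ≤ U → U ≤ 24 → (∃ g : ℝ, 0 < g ∧ ∃ L₀ : ℕ, ∀ L : ℕ, L₀ ≤ L → Even L → g ≤ chargeGap (fermionTorusGraph 2 L) 1 U (L ^ 2)) → (∃ b : ℝ, 0 < b ∧ ∃ L₀ : ℕ, ∀ L : ℕ, L₀ ≤ L → Even L → b ≤ 2 * groundEnergyAt (fermionTorusGraph 2 L) 1 U (L ^ 2 - 1) - groundEnergyAt (fermionTorusGraph 2 L) 1 U (L ^ 2) - groundEnergyAt (fermionTorusGraph 2 L) 1 U (L ^ 2 - 2)) → ∃ δ₀ : ℝ, 0 < δ₀ ∧ ∃ b' : ℝ, 0 < b' ∧ (∃ L₀ : ℕ, ∀ L :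 ℕ, L₀ ≤ L → Even L → ∀ N : ℕ, Even N → (1 - δ₀) * (L : ℝ) ^ 2 ≤ N → N + 2 ≤ L ^ 2 → b' ≤ chargeGap (fermionTorusGraph 2 L) 1 U N)) → (∀ U : ℝ, 12 ≤ U → U ≤ 24 → (∃ g : ℝ, 0 < g ∧ ∃ L₀ : ℕ, ∀ L : ℕ, L₀ ≤ L → Even L → g ≤ chargeGap (fermionTorusGraph 2 L) 1 U (L ^ 2)) → ∀ δ₀ b' : ℝ, 0 < δ₀ → 0 < b' → (∃ L₀ : ℕ, ∀ L : ℕ, L₀ ≤ L → Even L → ∀ N : ℕ, Even N → (1 - δ₀) * (L : ℝ) ^ 2 ≤ N → N + 2 ≤ L ^ 2 → b' ≤ chargeGap (fermionTorusGraph 2 L) 1 U N) → ∃ δ : ℝ, 0 < δ ∧ δ ≤ δ₀ ∧ δ < 1 / 2 ∧ ∃ c : ℝ, 0 < c ∧ ∃ L₀ : ℕ, ∀ L : ℕ, L₀ ≤ L → Even L → ∀ ψ : Fock (Orb (FermionTorus 2 L)), star ψ ⬝ᵥ ψ = 1 → IsGroundStateInSector (hubbardTorus 2 L 1 U) (2 *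 ⌊(1 - δ) * (L : ℝ) ^ 2 / 2⌋₊) 0 ψ → ∃ v : Orb (FermionTorus 2 L) × Orb (FermionTorus 2 L) → ℂ, ∃ ev : ℝ, star v ⬝ᵥ v = 1 ∧ twoParticleRDM ψ *ᵥ v = (ev : ℂ) • v ∧ c * (L : ℝ) ^ 2 ≤ ev) → (∀ U : ℝ, 12 ≤ U → U ≤ 24 → (∃ b : ℝ, 0 < b ∧ ∃ L₀ : ℕ, ∀ L : ℕ, L₀ ≤ L → Even L → b ≤ 2 * groundEnergyAt (fermionTorusGraph 2 L) 1 U (L ^ 2 - 1) - groundEnergyAt (fermionTorusGraph 2 L) 1 U (L ^ 2) - groundEnergyAt (fermionTorusGraph 2 L) 1 U (L ^ 2 - 2)) → (∃ z : ℝ, 0 < z ∧ ∃ L₀ : ℕ, ∀ (L : ℕ) [NeZero L], L₀ ≤ L → Even L → ∃ φ₂ ψ₀ : Fock (Orb (FermionTorus 2 L)), IsGroundState (hubbardTorus 2 L 1 U) (L ^ 2 - 2) φ₂ ∧ star φ₂ ⬝ᵥ φ₂ = 1 ∧ IsGroundState (hubbardTorus 2 L 1 U) (L ^ 2) ψ₀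 ∧ star ψ₀ ⬝ᵥ ψ₀ = 1 ∧ z * (L : ℝ) ^ 2 ≤ ‖star φ₂ ⬝ᵥ (pairField dWaveFormFactor L *ᵥ ψ₀)‖ ^ 2) → ∃ δ₁ : ℝ, 0 < δ₁ ∧ ∀ δ : ℝ, 0 < δ → δ ≤ δ₁ → ∀ c : ℝ, 0 < c → ∃ c' : ℝ, 0 < c' ∧ ∃ L₀ : ℕ, ∀ (L : ℕ) [NeZero L], L₀ ≤ L → Even L → ∀ ψ : Fock (Orb (FermionTorus 2 L)), star ψ ⬝ᵥ ψ = 1 → IsGroundStateInSector (hubbardTorus 2 L 1 U) (2 * ⌊(1 - δ) * (L : ℝ) ^ 2 / 2⌋₊) 0 ψ → (∃ v : Orb (FermionTorus 2 L) × Orb (FermionTorus 2 L) → ℂ, ∃ ev : ℝ, star v ⬝ᵥ v = 1 ∧ twoParticleRDM ψ *ᵥ v = (ev : ℂ) • v ∧ c * (L : ℝ) ^ 2 ≤ ev) → ∃ v : Orb (FermionTorus 2 L) × Orb (FermionTorus 2 L) → ℂ, ∃ ev : ℝ, star v ⬝ᵥ v = 1 ∧ twoParticleRDM ψ *ᵥ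 v = (ev : ℂ) • v ∧ c * (L : ℝ) ^ 2 ≤ ev ∧ c' * (L : ℝ) ^ 2 ≤ ‖star v ⬝ᵥ pairFieldWavefunction dWaveFormFactor L‖ ^ 2) → Summit.HubbardSuperconductivity.HubbardSuperconductivity.Theses.ParentFirstSMA.DiluteDWavePairsCondense := by
  intro h₁ h₂ h₃ U hU12 hU24 hA hB hC
  -- Stub 1: the pairing-gap window `(0, δ₀]` with margin `b'`
  obtain ⟨δ₀, hδ₀, b', hb', L₁, hW⟩ := h₁ U hU12 hU24 hA hB
  -- Stub 3: the locking window `(0, δ₁]`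
  obtain ⟨δ₁, hδ₁, hLock⟩ := h₃ U hU12 hU24 hB hC
  -- restrict the pairing-gap window to `δ* = min δ₀ δ₁`
  have hW' : ∃ L₀ : ℕ, ∀ L : ℕ, L₀ ≤ L → Even L → ∀ N : ℕ, Even N →
      (1 - min δ₀ δ₁) * (L : ℝ) ^ 2 ≤ N → N + 2 ≤ L ^ 2 → b' ≤ chargeGap (fermionTorusGraph 2 L) 1 U N := by
    refine ⟨L₁, fun L hL hLe N hNe hlo hhi => hW L hL hLe N hNe (le_trans ?_ hlo) hhi⟩
    have hm : min δ₀ δ₁ ≤ δ₀ := min_le_left _ _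
    have hL2 : (0 : ℝ) ≤ (L : ℝ) ^ 2 := by positivity
    nlinarith
  -- Stub 2: condensation at some `δ ≤ δ*`
  obtain ⟨δ, hδ, hδle, hδhalf, c, hc, L₂, hCond⟩ :=
    h₂ U hU12 hU24 hA (min δ₀ δ₁) b' (lt_min hδ₀ hδ₁) hb' hW'
  -- Stub 3 at this `δ` and at the condensation threshold `c`
  obtain ⟨c', hc', L₃, hLock'⟩ := hLock δ hδ (hδle.trans (min_le_right _ _)) c hc
  refine ⟨δ, ⟨hδ, hδhalf⟩, ?_⟩
  intro N ψ hseq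
  -- even-side LRO bookkeeping (tree): it suffices to bound `Σ_{x,y} G_{n+1}(x,y)` below by `(c c') (n+1)⁴`
  refine hasLongRangeOrder_even_of_le dWaveFormFactor ψ (fun n hn => (hseq (n + 1) hn).2.1)
    (a := c * c') (mul_pos hc hc') (max L₂ L₃) ?_
  intro n hn hK
  obtain ⟨hN, hnorm, hGS⟩ := hseq (n + 1) hn
  rw [hN] at hGS
  have hL₂ : L₂ ≤ n + 1 := le_trans (le_max_left _ _) hK
  have hL₃ : L₃ ≤ n + 1 := le_trans (le_max_right _ _) hK
  obtain ⟨v, ev, hv1, hev, hcL, hov⟩ :=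
    hLock' (n + 1) hL₃ hn (ψ (n + 1)) hnorm hGS (hCond (n + 1) hL₂ hn (ψ (n + 1)) hnorm hGS)
  -- `Σ_{x,y} G = re ⟨Δ_d† Δ_d⟩ = re (φ_d† ρ₂ φ_d)`
  rw [sum_pairFieldCorr_succ dWaveFormFactor ψ n,
    expect_pairField_eq_dotProduct_twoParticleRDM dWaveFormFactor (n + 1)
      expect_pairAnnihilator_conjTranspose_mul_holds (pairField_eq_pairAnnihilator_dWave (n + 1))]
  -- Yang: `ev ‖⟨v, φ_d⟩‖² ≤ re (φ_d† ρ₂ φ_d)` for the unit eigenvector `v` of the Gram matrix `ρ₂`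
  have hkey := re_dotProduct_mulVec_ge_of_eigenvector
    (fun u : Orb (FermionTorus 2 (n + 1)) × Orb (FermionTorus 2 (n + 1)) → ℂ =>
      pairAnnihilator u *ᵥ ψ (n + 1))
    (fun x y => by simp only [pairAnnihilator_add, add_mulVec])
    (fun a x => by simp only [pairAnnihilator_smul, smul_mulVec])
    (twoParticleRDM (ψ (n + 1))) (star_dotProduct_twoParticleRDM_mulVec (ψ (n + 1))) v
    (pairFieldWavefunction dWaveFormFactor (n + 1)) ev hv1 hev
  have hcL0 : (0 : ℝ) ≤ c * ((n + 1 : ℕ) : ℝ) ^ 2 := by positivity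
  have hev0 : (0 : ℝ) ≤ ev := le_trans hcL0 hcL
  calc c * c' * ((n + 1 : ℕ) : ℝ) ^ 4
      = (c * ((n + 1 : ℕ) : ℝ) ^ 2) * (c' * ((n + 1 : ℕ) : ℝ) ^ 2) := by ring
    _ ≤ ev * ‖star v ⬝ᵥ pairFieldWavefunction dWaveFormFactor (n + 1)‖ ^ 2 :=
        mul_le_mul hcL hov (by positivity) hev0
    _ ≤ _ := hkey

end Summit.HubbardSuperconductivity.HubbardSuperconductivity.Theorems.ParentFirstSMA

end
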